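import Summits.KontsevichZagierPeriods.Zeta5Search.LaiSweepShard

/-!
# `κ₃` sweep certificate — shard file 080 of 127 (shards 560–566 of 889)

HONEST FRAMING. Systematic search; no irrationality claim unless certified. This file only checks,
by `decide +kernel`, shards 560–566 of the order-cell sweep of the `κ₃` point `(74, 2180, 444; δ74)`
(engine `LaiSweepEngine`, soundness `LaiSweepJump/Free/Eval/Shard/Kappa3`; a shard is `⟨regime, n,
p, q, p', q', Lo, Up⟩`: `n` cells from `p/q` to `p'/q'` with integer rate sums in `[Lo, Up]`, `K =
128`, `D = 2^40`). It draws NO conclusion: only the capstone `LaiKappa3SweepCert`, which needs all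
127 shard files, does. Kernel cost of this file ≈ 560 cells × 0.3 s.
-/

namespace Summit.KontsevichZagierPeriods.Zeta5Search.Sweep

set_option maxHeartbeats 100000000 in
/-- Shard 560: 80 cells of regime B from `78/133` to `258/439`.
[cite: Lai2024BallRivoal, §4 Lemma 4.3] -/
theorem shard560 :
    Shard.check 128 (2^40)
      ⟨true, 80, 78, 133, 258, 439, 13203741735064, 17206840942911⟩ = true := by
  decide +kernel

set_option maxHeartbeats 100000000 in
/-- Shard 561: 80 cells of regime B from `258/439` to `139/236`.
[cite: Lai2024BallRivoal, §4 Lemma 4.3] -/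
theorem shard561 :
    Shard.check 128 (2^40)
      ⟨true, 80, 258, 439, 139, 236, 13727567452797, 17907824294487⟩ = true := by
  decide +kernel

set_option maxHeartbeats 100000000 in
/-- Shard 562: 80 cells of regime B from `139/236` to `206/349`.
[cite: Lai2024BallRivoal, §4 Lemma 4.3] -/
theorem shard562 :
    Shard.check 128 (2^40)
      ⟨true, 80, 139, 236, 206, 349, 13615308067344, 17779371127769⟩ = true := by
  decide +kernel

set_option maxHeartbeats 100000000 in
/-- Shard 563: 80 cells of regime B from `206/349` to `181/306`.
[cite: Lai2024BallRivoal, §4 Lemma 4.3] -/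
theorem shard563 :
    Shard.check 128 (2^40)
      ⟨true, 80, 206, 349, 181, 306, 13283465499718, 17363690406018⟩ = true := by
  decide +kernel

set_option maxHeartbeats 100000000 in
/-- Shard 564: 80 cells of regime B from `181/306` to `131/221`.
[cite: Lai2024BallRivoal, §4 Lemma 4.3] -/
theorem shard564 :
    Shard.check 128 (2^40)
      ⟨true, 80, 181, 306, 131, 221, 13384259527529, 17513033490850⟩ = true := by
  decide +kernel

set_option maxHeartbeats 100000000 in
/-- Shard 565: 80 cells of regime B from `131/221` to `139/234`.
[cite: Lai2024BallRivoal, §4 Lemma 4.3] -/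
theorem shard565 :
    Shard.check 128 (2^40)
      ⟨true, 80, 131, 221, 139, 234, 13370574842805, 17512818037098⟩ = true := by
  decide +kernel

set_option maxHeartbeats 100000000 in
/-- Shard 566: 80 cells of regime B from `139/234` to `228/383`.
[cite: Lai2024BallRivoal, §4 Lemma 4.3] -/
theorem shard566 :
    Shard.check 128 (2^40)
      ⟨true, 80, 139, 234, 228, 383, 13627299264215, 17867355257495⟩ = true := by
  decide +kernel

/-- The checked shards of this file, in order. [folklore] -/
def shards080 : List (CheckedShard 128 (2^40)) :=
  [⟨_, shard560⟩, ⟨_, shard561⟩, ⟨_, shard562⟩, ⟨_, shard563⟩, ⟨_, shard564⟩,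
    ⟨_, shard565⟩, ⟨_, shard566⟩]

end Summit.KontsevichZagierPeriods.Zeta5Search.Sweep
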